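import Summits.Ventures.PercRepro.C026SeriesParallel
import Summits.Ventures.PercRepro.C026AcyclicHalf

/-!
# `Q3½` at every `p` on every marked multigraph that series–parallel–pendant-reduces to a forest (p6, gen 10)

The reduction steps of `C026SeriesParallel.lean` leave the five rows of `law3` unchanged, so any inequality
in the rows transports backwards along a chain; here mine-3's `Q3½` (`Q3halfAt`), with the endpoint
«the live minor is acyclic» — stated on `G` itself through `AcyclicOn G u` (no closed `u`-edge has its ends
joined by `u`-open edges), which passes to the live minor (`AcyclicOn.minor_bot`).

* `Q3halfAt`, `Q3halfAt_of_step`, `Q3halfAt_of_reduces'`;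
* `AcyclicOn`, `AcyclicOn.mono`, `AcyclicOn.minor_bot`, `Acyclic.acyclicOn`;
* **`Q3halfAt_of_reduces_acyclic`** — `Q3½` at `p` for every instance that reduces to an acyclic live graph.
-/

namespace PercRepro

namespace MultiGraph

variable {V E : Type} [Fintype E] [DecidableEq E]

/-- **mine-3's `Q3½`** at the weight `p`: `3·x ≤ u·(1 + 2·v)`. -/
def Q3halfAt (G : MultiGraph V E) (p : E → ℝ) (a b c : V) : Prop :=
  3 * G.law3 p a b c 0 ≤
    (G.law3 p a b c 0 + G.law3 p a b c 2 + G.law3 p a b c 3) *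
      (1 + 2 * (G.law3 p a b c 0 + G.law3 p a b c 1))

/-- **`Q3½` transports backwards along a step.** -/
theorem Q3halfAt_of_step {a b c : V} {x y : MultiGraph V E × (E → ℝ)} (h : SPStep3 a b c x y)
    (hy : y.1.Q3halfAt y.2 a b c) : x.1.Q3halfAt x.2 a b c := by
  cases h with
  | @series G p e₁ e₂ x y z hs hx =>
    unfold Q3halfAt at hy ⊢
    rw [hs.law3 p hx]
    exact hy
  | @parallel G p e₁ e₂ hne hpar =>
    unfold Q3halfAt at hy ⊢
    rw [law3_parallel hne hpar p a b c]
    exact hy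
  | @pendant G p v w hpv hvw hv f hf =>
    unfold Q3halfAt at hy ⊢
    rw [law3_pendant hpv hvw hv hf p]
    exact hy

/-- **`Q3½` transports backwards along a reduction.** -/
theorem Q3halfAt_of_reduces' {a b c : V} {x y : MultiGraph V E × (E → ℝ)} (h : Reduces3 a b c x y)
    (hy : y.1.Q3halfAt y.2 a b c) : x.1.Q3halfAt x.2 a b c := by
  induction h using Relation.ReflTransGen.head_induction_on with
  | refl => exact hy
  | head hstep _ ih => exact Q3halfAt_of_step hstep ih

omit [Fintype E] [DecidableEq E] in
/-- **Acyclic on the `u`-edges**: in every configuration below `u`, a closed `u`-edge never has its ends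
joined. -/
def AcyclicOn (G : MultiGraph V E) (u : Config E) : Prop :=
  ∀ ω : Config E, ω ≤ u → ∀ e, u e = true → ω e = false → ¬ G.Conn ω (G.fst e) (G.snd e)

omit [Fintype E] [DecidableEq E] in
/-- Fewer edges keep the property. -/
theorem AcyclicOn.mono {G : MultiGraph V E} {u u' : Config E} (h : u' ≤ u) (hu : G.AcyclicOn u) :
    G.AcyclicOn u' :=
  fun ω hω e he => hu ω (hω.trans h) e (Bool.le_iff_imp.1 (h e) he)

omit [Fintype E] [DecidableEq E] in
/-- An acyclic multigraph is acyclic on every edge set. -/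
theorem Acyclic.acyclicOn {G : MultiGraph V E} (hG : G.Acyclic) (u : Config E) : G.AcyclicOn u :=
  fun ω _ e _ he => hG ω e he

omit [Fintype E] [DecidableEq E] in
/-- **The minor on the `u`-edges is acyclic** when `G` is acyclic on the `u`-edges. -/
theorem AcyclicOn.minor_bot {G : MultiGraph V E} {u : Config E} (hu : G.AcyclicOn u) :
    (G.minor u ⊥).Acyclic := by
  intro ρ e he h
  have h' : G.Conn (embed u ⊥ ρ) (G.fst e.1) (G.snd e.1) := (G.conn_embed_iff u ⊥ ρ _ _).2 h
  have he' : embed u ⊥ ρ e.1 = false := by rw [embed_apply_of_mem u ⊥ ρ e.2]; exact he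
  exact hu (embed u ⊥ ρ) (embed_bot_le u ρ) e.1 e.2.2 he' h'

/-- **The acyclic endpoint**: `Q3½` at `p` when `G` is acyclic on its live edges. -/
theorem Q3halfAt_of_acyclicOn_live (G : MultiGraph V E) {p : E → ℝ} (hp : IsProb p) (a b c : V)
    (h : G.AcyclicOn (liveConfig p)) : G.Q3halfAt p a b c := by
  unfold Q3halfAt
  rw [G.law3_eq_liveMinor p a b c]
  exact h.minor_bot.q3half _ _ _ _ (isProb_faceWeight hp _ _)

/-- **`Q3½` for every instance that series–parallel–pendant-reduces to an acyclic live graph.** -/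
theorem Q3halfAt_of_reduces_acyclic {a b c : V} {G G' : MultiGraph V E} {p p' : E → ℝ} (hp : IsProb p)
    (h : Reduces3 a b c (G, p) (G', p')) (hG' : G'.AcyclicOn (liveConfig p')) :
    G.Q3halfAt p a b c :=
  Q3halfAt_of_reduces' h (G'.Q3halfAt_of_acyclicOn_live (h.isProb hp) a b c hG')

end MultiGraph

end PercRepro
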